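import Mathlib.Analysis.Complex.Polynomial.Basic
import Mathlib.FieldTheory.IsAlgClosed.Basic
import Mathlib.FieldTheory.Minpoly.Basic
import Mathlib.RingTheory.Localization.FractionRing
import Literature.NumberTheory.Transcendental.IntersectionsWithTori
import Literature.NumberTheory.Transcendental.DerivationExtension
import Literature.NumberTheory.Transcendental.AxDerivationTools
import Literature.RingTheory.KrullDimension.AffineDimension
import HarnessLib

/-!
# Weak CIT, step 3a: generic points of irreducible subvarieties of the torus

Support file for the discharge of `Literature.NumberTheory.Transcendental.weakCIT`
(`IntersectionsWithTori.lean`). For an irreducible closed subset `X` of the torus `(ℂˣ)ⁿ`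
(`Literature.NumberTheory.Transcendental.IsIrreducibleInTorus`), its vanishing ideal
`P = I(X) ⊆ ℂ[Y₁, …, Yₙ]` is prime and contains no variable (`isPrime_vanishingIdeal`,
`X_notMem_vanishingIdeal`); the classes `ȳᵢ` of the coordinates in the function field
`K = Frac(ℂ[Y]/P)` form the *generic point* of `X` (`aeval_genPt_eq_zero_iff`: a polynomial
vanishes at `ȳ` iff it lies in `P`; Zilber 2005 §3, Marker 2006 §1 — the `Fin n ⊕ Fin n`-indexed
version is `ExpVarietiesDimension.lean`). We then fix, once and for all by choice, a transcendence
basis of `ℂ[Y]/P` over `ℂ` *among the coordinate classes* (`basisSet`, indexed by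
`basisIdx P ⊆ Fin n`, of cardinality `dim X`, `card_basisIdx`), the dual derivations
`∂ₐ` of `K/ℂ` (`basisDerivation`: `∂ₐ b = δ_{ab} b` on basis elements), and prove that an element
of `K` killed by all `∂ₐ` is a complex number (`mem_range_of_forall_basisDerivation_eq_zero`:
it is algebraic over `ℂ`, which is algebraically closed). This is the "`rk Jac(y) = dim X` for
`y` generic in `X` over `C`" step of Kirby 2009, proof of Thm 4.6.

## References

* J. Kirby, *The theory of the exponential differential equations of semiabelian varieties*,
  Selecta Math. 15 (2009) 445–486, proof of Thm 4.6.
* D. Marker, *Model theory: an introduction*, GTM 217, §1 (generic points).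
-/

noncomputable section

open MvPolynomial Set

namespace Literature.NumberTheory.Transcendental.WeakCIT

variable {n : ℕ}

/-! ### The vanishing ideal of an irreducible subset of the torus -/

section Vanishing

variable {K : Type*} [Field K]

/-- A non-empty trace `X̄ ∩ (Kˣ)ⁿ` of an irreducible closed `X̄` on the torus has the same vanishing
ideal as `X̄`: if `f` vanishes on the trace then `f · ∏ Yᵢ` vanishes on `X̄`, and `∏ Yᵢ ∉ I(X̄)`.
[folklore] -/
theorem vanishingIdeal_inter_unitLocus {Xc : Set (Fin n → K)} (hXc : IsIrreducibleClosed K Xc)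
    (hne : (Xc ∩ unitLocus K n).Nonempty) :
    vanishingIdeal K (Xc ∩ unitLocus K n) = vanishingIdeal K Xc := by
  refine le_antisymm (fun f hf => ?_) (vanishingIdeal_anti_mono Set.inter_subset_left)
  rw [mem_vanishingIdeal_iff] at hf
  have hg : f * ∏ i, X i ∈ vanishingIdeal K Xc := by
    rw [mem_vanishingIdeal_iff]
    intro z hz
    rw [map_mul, map_prod]
    by_cases hzU : z ∈ unitLocus K n
    · rw [hf z ⟨hz, hzU⟩, zero_mul]
    · simp only [mem_unitLocus_iff, not_forall, not_not] at hzU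
      obtain ⟨i, hi⟩ := hzU
      rw [Finset.prod_eq_zero (Finset.mem_univ i) (by rw [aeval_X, hi]), mul_zero]
  rcases hXc.2.mem_or_mem hg with h | h
  · exact h
  · exfalso
    obtain ⟨z, hzc, hzU⟩ := hne
    rw [mem_vanishingIdeal_iff] at h
    have := h z hzc
    rw [map_prod] at this
    simp only [aeval_X] at this
    exact Finset.prod_ne_zero_iff.mpr (fun i _ => hzU i) this

/-- The vanishing ideal of an irreducible closed subset of the torus is prime. [folklore] -/
theorem isPrime_vanishingIdeal {X : Set (Fin n → K)} (hX : IsIrreducibleInTorus K n X) :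
    (vanishingIdeal K X).IsPrime := by
  obtain ⟨Xc, hXc, rfl, hne⟩ := hX
  rw [vanishingIdeal_inter_unitLocus hXc hne]
  exact hXc.2

/-- No coordinate function vanishes on a non-empty subset of the torus. [folklore] -/
theorem X_notMem_vanishingIdeal {X : Set (Fin n → K)} (hX : X ⊆ unitLocus K n)
    (hne : X.Nonempty) (i : Fin n) : (MvPolynomial.X i : MvPolynomial (Fin n) K) ∉ vanishingIdeal K X := by
  obtain ⟨z, hz⟩ := hne
  rw [mem_vanishingIdeal_iff]
  intro h
  have := h z hz
  rw [aeval_X] at this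
  exact hX hz i this

/-- An irreducible closed subset of the torus lies in the torus and is non-empty. [folklore] -/
theorem IsIrreducibleInTorus.subset_unitLocus {X : Set (Fin n → K)} (hX : IsIrreducibleInTorus K n X) :
    X ⊆ unitLocus K n ∧ X.Nonempty := by
  obtain ⟨Xc, -, rfl, hne⟩ := hX
  exact ⟨Set.inter_subset_right, hne⟩

end Vanishing

/-! ### Coordinate ring, function field and generic point of a prime -/

section GenericPoint

variable (P : Ideal (MvPolynomial (Fin n) ℂ))

/-- The coordinate ring `ℂ[Y₁, …, Yₙ] ⧸ P`. [folklore] -/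
abbrev CoordRing : Type := MvPolynomial (Fin n) ℂ ⧸ P

/-- The function field `Frac(ℂ[Y] ⧸ P)`. [folklore] -/
abbrev FuncField : Type := FractionRing (CoordRing P)

/-- The coordinate classes `Ȳᵢ ∈ ℂ[Y] ⧸ P`. [folklore] -/
def coordFn (i : Fin n) : CoordRing P := Ideal.Quotient.mk P (X i)

/-- **The generic point** `ȳ ∈ Kⁿ` of `Z(P)`, `K = Frac(ℂ[Y] ⧸ P)`: the coordinate classes in the
function field. [cite: Marker2006, §1] -/
def genPt (i : Fin n) : FuncField P := algebraMap (CoordRing P) (FuncField P) (coordFn P i)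

/-- Evaluation at the coordinate classes is the quotient map. [folklore] -/
theorem aeval_coordFn (p : MvPolynomial (Fin n) ℂ) : aeval (coordFn P) p = Ideal.Quotient.mk P p := by
  have : (aeval (coordFn P) : MvPolynomial (Fin n) ℂ →ₐ[ℂ] CoordRing P) = Ideal.Quotient.mkₐ ℂ P :=
    MvPolynomial.algHom_ext fun i => by simp [coordFn]
  rw [this]
  rfl

/-- Evaluation at the generic point is the class in the function field. [folklore] -/
theorem aeval_genPt (p : MvPolynomial (Fin n) ℂ) :
    aeval (genPt P) p = algebraMap (CoordRing P) (FuncField P) (Ideal.Quotient.mk P p) := by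
  have : (aeval (genPt P) : MvPolynomial (Fin n) ℂ →ₐ[ℂ] FuncField P) =
      (IsScalarTower.toAlgHom ℂ (CoordRing P) (FuncField P)).comp (aeval (coordFn P)) :=
    MvPolynomial.algHom_ext fun i => by simp [genPt, coordFn]
  rw [this, AlgHom.comp_apply, aeval_coordFn]
  rfl

/-- **`I(ȳ/ℂ) = P`**: a polynomial vanishes at the generic point iff it lies in `P`.
[cite: Marker2006, §1] -/
theorem aeval_genPt_eq_zero_iff (p : MvPolynomial (Fin n) ℂ) : aeval (genPt P) p = 0 ↔ p ∈ P := by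
  rw [aeval_genPt, map_eq_zero_iff _ (IsFractionRing.injective (CoordRing P) (FuncField P)),
    Ideal.Quotient.eq_zero_iff_mem]

/-- The generic point has non-zero coordinates as soon as no variable lies in `P`. [folklore] -/
theorem genPt_ne_zero {i : Fin n} (hi : (X i : MvPolynomial (Fin n) ℂ) ∉ P) : genPt P i ≠ 0 := by
  intro h
  apply hi
  rw [← aeval_genPt_eq_zero_iff P (X i), aeval_X]
  exact h

/-- The coordinate classes generate the coordinate ring. [folklore] -/
theorem adjoin_range_coordFn : Algebra.adjoin ℂ (Set.range (coordFn P)) = ⊤ := by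
  rw [Algebra.adjoin_range_eq_range_aeval, AlgHom.range_eq_top]
  intro a
  obtain ⟨p, rfl⟩ := Ideal.Quotient.mk_surjective a
  exact ⟨p, aeval_coordFn P p⟩

end GenericPoint

/-! ### A transcendence basis among the coordinate classes -/

section Basis

variable (P : Ideal (MvPolynomial (Fin n) ℂ)) [P.IsPrime]

/-- There is a transcendence basis of `ℂ[Y] ⧸ P` over `ℂ` consisting of coordinate classes.
[folklore] -/
theorem exists_basisSet : ∃ u : Set (CoordRing P), u ⊆ Set.range (coordFn P) ∧
    IsTranscendenceBasis ℂ ((↑) : u → CoordRing P) := by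
  haveI : Algebra.IsAlgebraic (Algebra.adjoin ℂ (Set.range (coordFn P))) (CoordRing P) :=
    ⟨fun b => isAlgebraic_algebraMap
      (⟨b, by rw [adjoin_range_coordFn]; exact Algebra.mem_top⟩ : Algebra.adjoin ℂ (Set.range (coordFn P)))⟩
  obtain ⟨u, -, hu, hb⟩ := exists_isTranscendenceBasis_between (R := ℂ) (A := CoordRing P) ∅
    (Set.range (coordFn P)) (Set.empty_subset _)
    ((algebraicIndependent_empty_iff ℂ (CoordRing P)).mpr (algebraMap ℂ (CoordRing P)).injective)
  exact ⟨u, hu, hb⟩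

/-- A chosen transcendence basis of `ℂ[Y] ⧸ P` over `ℂ` among the coordinate classes. [folklore] -/
def basisSet : Set (CoordRing P) := (exists_basisSet P).choose

/-- The chosen basis consists of coordinate classes. [folklore] -/
theorem basisSet_subset : basisSet P ⊆ Set.range (coordFn P) := (exists_basisSet P).choose_spec.1

/-- The chosen basis is a transcendence basis. [folklore] -/
theorem isTranscendenceBasis_basisSet : IsTranscendenceBasis ℂ ((↑) : basisSet P → CoordRing P) :=
  (exists_basisSet P).choose_spec.2

/-- A chosen coordinate index for each basis element. [folklore] -/
def idx (a : basisSet P) : Fin n := (basisSet_subset P a.2).choose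

/-- The chosen index recovers the basis element. [folklore] -/
theorem coordFn_idx (a : basisSet P) : coordFn P (idx P a) = a := (basisSet_subset P a.2).choose_spec

/-- The index assignment is injective. [folklore] -/
theorem idx_injective : Function.Injective (idx P) := fun a b h =>
  Subtype.ext (by rw [← coordFn_idx P a, ← coordFn_idx P b, h])

/-- The set `S ⊆ Fin n` of indices of the chosen transcendence basis. [folklore] -/
def basisIdx : Finset (Fin n) := by
  classical
  exact Finset.univ.filter fun i => i ∈ Set.range (idx P)

/-- Membership in `basisIdx`. [folklore] -/
theorem mem_basisIdx_iff {i : Fin n} : i ∈ basisIdx P ↔ i ∈ Set.range (idx P) := by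
  classical
  simp [basisIdx]

/-- Coordinates indexed by `basisIdx` are basis elements. [folklore] -/
theorem coordFn_mem_basisSet {i : Fin n} (hi : i ∈ basisIdx P) : coordFn P i ∈ basisSet P := by
  obtain ⟨a, rfl⟩ := (mem_basisIdx_iff P).mp hi
  rw [coordFn_idx]
  exact a.2

/-- On `basisIdx` the coordinate classes are pairwise distinct. [folklore] -/
theorem coordFn_injOn {i j : Fin n} (hi : i ∈ basisIdx P) (hj : j ∈ basisIdx P)
    (h : coordFn P i = coordFn P j) : i = j := by
  obtain ⟨a, rfl⟩ := (mem_basisIdx_iff P).mp hi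
  obtain ⟨b, rfl⟩ := (mem_basisIdx_iff P).mp hj
  rw [coordFn_idx, coordFn_idx] at h
  rw [Subtype.ext h]

/-- **`|S| = dim`**: the number of basis indices is the Krull dimension of `ℂ[Y] ⧸ P`
(dimension = transcendence degree for affine domains). [cite: Matsumura1987, Thm 5.6] -/
theorem card_basisIdx : (((basisIdx P).card : ℕ∞) : WithBot ℕ∞) = ringKrullDim (CoordRing P) := by
  classical
  have h1 : ((basisIdx P : Set (Fin n))) = Set.range (idx P) := by
    ext i
    simp [mem_basisIdx_iff]
  have h2 : Cardinal.mk ((basisIdx P : Set (Fin n))) = Cardinal.mk (basisSet P) := by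
    rw [h1]
    exact Cardinal.mk_range_eq _ (idx_injective P)
  have h3 : Cardinal.mk (basisSet P) = Algebra.trdeg ℂ (CoordRing P) :=
    (isTranscendenceBasis_basisSet P).cardinalMk_eq_trdeg
  have h4 : Cardinal.mk ((basisIdx P : Set (Fin n))) = ((basisIdx P).card : Cardinal) :=
    Cardinal.mk_coe_finset (s := basisIdx P)
  rw [Literature.RingTheory.KrullDimension.ringKrullDim_eq_trdeg ℂ (CoordRing P), ← h3, ← h2, h4,
    Cardinal.toNat_natCast]
  rfl

/-! ### Dual derivations of the function field -/

/-- The function field is algebraic over the coordinate ring (instance for this file).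
[folklore] -/
instance isAlgebraic_funcField : Algebra.IsAlgebraic (CoordRing P) (FuncField P) :=
  IsLocalization.isAlgebraic (FuncField P) (nonZeroDivisors (CoordRing P))

/-- The coordinate ring embeds in its function field (instance for this file). [folklore] -/
instance faithfulSMul_funcField : FaithfulSMul (CoordRing P) (FuncField P) :=
  (faithfulSMul_iff_algebraMap_injective _ _).mpr (IsFractionRing.injective (CoordRing P) (FuncField P))

/-- The chosen basis, mapped to the function field, is a transcendence basis of `K/ℂ`.
[folklore] -/
theorem isTranscendenceBasis_funcField :
    IsTranscendenceBasis ℂ (algebraMap (CoordRing P) (FuncField P) ∘ ((↑) : basisSet P → CoordRing P)) :=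
  (isTranscendenceBasis_basisSet P).algebraMap_comp

open Classical in
/-- For each basis element `a` there is a `ℂ`-derivation `∂ₐ` of `K` with `∂ₐ b = δ_{ab} b` on the
basis (derivations with prescribed values on an algebraically independent family,
`exists_derivation_of_algebraicIndependent`). [cite: Rosenlicht1976, Prop. 3] -/
theorem exists_basisDerivation (a : basisSet P) :
    ∃ δ : Derivation ℂ (FuncField P) (FuncField P), ∀ b : basisSet P,
      δ (algebraMap (CoordRing P) (FuncField P) b) =
        if a = b then algebraMap (CoordRing P) (FuncField P) b else 0 := by
  classical
  haveI : Fintype (basisSet P) :=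
    Fintype.ofInjective (idx P) (idx_injective P)
  obtain ⟨δ, hδ⟩ := exists_derivation_of_algebraicIndependent (k := ℂ) (K := FuncField P)
    (isTranscendenceBasis_funcField P).1
    (fun b => if a = b then algebraMap (CoordRing P) (FuncField P) b else 0)
  exact ⟨δ, fun b => hδ b⟩

open Classical in
/-- The dual derivations `∂ₐ` (`a` in the chosen basis) of the function field. [folklore] -/
def basisDerivation (a : basisSet P) : Derivation ℂ (FuncField P) (FuncField P) :=
  (exists_basisDerivation P a).choose

open Classical in
/-- `∂ₐ b = δ_{ab} b` on basis elements. [folklore] -/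
theorem basisDerivation_apply_basis (a b : basisSet P) :
    basisDerivation P a (algebraMap (CoordRing P) (FuncField P) b) =
      if a = b then algebraMap (CoordRing P) (FuncField P) b else 0 :=
  (exists_basisDerivation P a).choose_spec b

/-- An element of a field extension of `ℂ` which is algebraic over `ℂ` is a complex number.
[folklore] -/
theorem mem_range_algebraMap_of_isAlgebraic {L : Type*} [Field L] [Algebra ℂ L] {z : L}
    (hz : IsAlgebraic ℂ z) : z ∈ Set.range (algebraMap ℂ L) := by
  have hdeg := IsAlgClosed.degree_eq_one_of_irreducible ℂ (minpoly.irreducible hz.isIntegral)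
  have := minpoly.mem_range_of_degree_eq_one ℂ z hdeg
  rwa [RingHom.mem_range] at this

/-- **Constants of the dual derivations are complex numbers**: an element of `K` killed by every
`∂ₐ` is algebraic over `ℂ` (a derivation of `K/ℂ` is determined by its values on a transcendence
basis, and a transcendental element is moved by some derivation), hence lies in `ℂ`.
[cite: Rosenlicht1976, Prop. 3] -/
theorem mem_range_of_forall_basisDerivation_eq_zero {z : FuncField P}
    (hz : ∀ a, basisDerivation P a z = 0) : z ∈ Set.range (algebraMap ℂ (FuncField P)) := by
  classical
  haveI : Fintype (basisSet P) := Fintype.ofInjective (idx P) (idx_injective P)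
  apply mem_range_algebraMap_of_isAlgebraic
  by_contra hzt
  obtain ⟨δ, hδ1⟩ := exists_derivation_eq_one_of_transcendental (k := ℂ) (K := FuncField P) hzt
  suffices h : δ z = 0 by rw [h] at hδ1; exact zero_ne_one hδ1
  set e : basisSet P → FuncField P :=
    algebraMap (CoordRing P) (FuncField P) ∘ ((↑) : basisSet P → CoordRing P) with he
  have he0 : ∀ b, e b ≠ 0 := fun b => (isTranscendenceBasis_funcField P).1.ne_zero b
  set c : basisSet P → FuncField P := fun a => δ (e a) * (e a)⁻¹ with hc
  -- evaluating the correcting sum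
  have hsum : ∀ w, (∑ a, c a • basisDerivation P a) w = ∑ a, c a * basisDerivation P a w := by
    intro w
    have h := congrFun (map_sum Derivation.coeFnAddMonoidHom
      (fun a => c a • basisDerivation P a) Finset.univ) w
    rw [Derivation.coeFnAddMonoidHom_apply, Finset.sum_apply] at h
    rw [h]
    refine Finset.sum_congr rfl fun a _ => ?_
    rw [Derivation.coeFnAddMonoidHom_apply, Derivation.coe_smul, Pi.smul_apply, smul_eq_mul]
  set δ' : Derivation ℂ (FuncField P) (FuncField P) :=
    δ - ∑ a, c a • basisDerivation P a with hδ'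
  -- `δ'` vanishes on the basis
  have hδ'e : ∀ b, δ' (e b) = 0 := by
    intro b
    rw [hδ', Derivation.sub_apply, hsum, sub_eq_zero]
    have : ∀ a, c a * basisDerivation P a (e b) = if a = b then δ (e b) else 0 := by
      intro a
      have hb : basisDerivation P a (e b) =
          if a = b then algebraMap (CoordRing P) (FuncField P) b else 0 :=
        basisDerivation_apply_basis P a b
      rw [hb]
      split_ifs with hab
      · subst hab
        rw [hc]
        show δ (e a) * (e a)⁻¹ * e a = δ (e a)
        rw [inv_mul_cancel_right₀ (he0 a)]
      · rw [mul_zero]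
    simp only [this, Finset.sum_ite_eq', Finset.mem_univ, if_true]
  -- hence on `ℂ(basis)`, hence (char 0, `K` algebraic over `ℂ(basis)`) on `z`
  set F' : IntermediateField ℂ (FuncField P) := IntermediateField.adjoin ℂ (Set.range e) with hF'
  haveI : CharZero F' := charZero_of_injective_algebraMap (algebraMap ℂ F').injective
  haveI : Algebra.IsAlgebraic F' (FuncField P) := (isTranscendenceBasis_funcField P).isAlgebraic_field
  have hF'0 : ∀ w : F', δ' (algebraMap F' (FuncField P) w) = 0 := fun w =>
    derivation_eq_zero_on_adjoin δ' (fun r => δ'.map_algebraMap r)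
      (by rintro _ ⟨b, rfl⟩; exact hδ'e b) w.2
  have hz' : δ' z = 0 :=
    derivation_eq_zero_of_isAlgebraic δ' hF'0 (Algebra.IsAlgebraic.isAlgebraic z)
  rw [hδ', Derivation.sub_apply, hsum, sub_eq_zero] at hz'
  rw [hz']
  exact Finset.sum_eq_zero fun a _ => by rw [hz a, mul_zero]

end Basis

end Literature.NumberTheory.Transcendental.WeakCIT
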